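import Summits.NavierStokesRegularity.NavierStokesRegularity.Theorems.HardyPointSinkHardyEnergyBoundLedgerSlice
import Literature.Analysis.FluidPDE.PressureNormalisationL3
import HarnessLib

/-!
# Route HardyPointSink — `HardyEnergyBound`, ledger stub: continuity in time of the slice integrals

Helper file 4/5 for the glue stub `stub_hardyLedger_of` (item stmt-NavierStokesRegularity-7979, line
`birth`). For jointly smooth fields `v`, `p` on an open time set `S` and a compact `K ⊆ S`, the slice
integrals of the ledger — the Hardy dissipation `∫φ|∇v(s)|²/r`, the identity's right side
`∫(A + B_p − C_p)(s)`, the sharp influx `∫_{B_R} flux_p(s)`, the moment `∫_{B_R}⟨v(s), x−x₀⟩/r³` and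
`∫_{B̄_R} p(s)` — are continuous on `K` (dominated convergence against the Newtonian weights).
-/

noncomputable section

open MeasureTheory Set Filter Topology Metric Function
open scoped ENNReal NNReal InnerProductSpace Laplacian

set_option linter.dupNamespace false -- nested layout Summit.<S>.<Sub>, Sub = S (D-0017)

namespace Summit.NavierStokesRegularity.NavierStokesRegularity.Theorems

open Literature.Analysis.FluidPDE Literature.Analysis.PDE


/-! ### Time lines and compact bounds of jointly smooth fields -/

/-- Time lines of a jointly smooth field are continuous on the time set. -/
theorem hardyEnergyBound_ledger_continuousOn_timeLine {F : Type*} [NormedAddCommGroup F]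
    [NormedSpace ℝ F] {K : Set ℝ} {w : ℝ → (EuclideanSpace ℝ (Fin 3)) → F} (hw : IsSmoothSpaceTimeOn K w) (x : (EuclideanSpace ℝ (Fin 3))) :
    ContinuousOn (fun s => w s x) K :=
  hw.continuousOn.comp (continuousOn_id.prodMk continuousOn_const) fun _ hs => ⟨hs, mem_univ _⟩

/-- A nonnegative compact bound of a jointly smooth field on `K × B̄(xs, R)`. -/
theorem hardyEnergyBound_ledger_exists_bound {F : Type*} [NormedAddCommGroup F] [NormedSpace ℝ F]
    {K : Set ℝ} (hK : IsCompact K) {w : ℝ → (EuclideanSpace ℝ (Fin 3)) → F} (hw : IsSmoothSpaceTimeOn K w) (xs : (EuclideanSpace ℝ (Fin 3))) (R : ℝ) :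
    ∃ M : ℝ, 0 ≤ M ∧ ∀ s ∈ K, ∀ x ∈ closedBall xs R, ‖w s x‖ ≤ M := by
  obtain ⟨M, hM⟩ := hw.exists_bound hK (isCompact_closedBall xs R)
  exact ⟨max M 0, le_max_right _ _, fun s hs x hx => (hM s hs x hx).trans (le_max_left _ _)⟩

section Time

variable {xs x₀ : (EuclideanSpace ℝ (Fin 3))} {R : ℝ} (hR : 0 < R) (hx₀ : x₀ ∈ ball xs (R / 4))
variable {L₁ L₂ : ℝ} (hL₁0 : 0 ≤ L₁) (hL₂0 : 0 ≤ L₂)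
  (hL₁ : ∀ x, ‖fderiv ℝ (hardyEnergyBound_ledger_cutoff xs hR) x‖ ≤ L₁)
  (hL₂ : ∀ x, |(Δ (hardyEnergyBound_ledger_cutoff xs hR)) x| ≤ L₂)
variable {S K : Set ℝ} (hS : IsOpen S) (hK : IsCompact K) (hKS : K ⊆ S)
variable {v : ℝ → (EuclideanSpace ℝ (Fin 3)) → (EuclideanSpace ℝ (Fin 3))} {p : ℝ → (EuclideanSpace ℝ (Fin 3)) → ℝ} (hv : IsSmoothSpaceTimeOn S v)
  (hp : IsSmoothSpaceTimeOn S p)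

/-! ### The Hardy dissipation `s ↦ ∫ φ |∇v(s)|² / r` -/

include hS hK hKS hv in
/-- **The localised Hardy dissipation is continuous in time** on `K`. -/
theorem hardyEnergyBound_ledger_continuousOn_dissipation :
    ContinuousOn (fun s => ∫ x, hardyEnergyBound_ledger_cutoff xs hR x *
      frobeniusNormSq (fderiv ℝ (v s) x) / ‖x - x₀‖) K := by
  set φ := hardyEnergyBound_ledger_cutoff xs hR with hφ
  have hD : IsSmoothSpaceTimeOn K (fun s x => fderiv ℝ (v s) x) :=
    (hv.fderiv_slice hS.uniqueDiffOn).mono hKS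
  -- a compact bound for the dissipation density
  obtain ⟨M, hM0, hM⟩ : ∃ M : ℝ, 0 ≤ M ∧ ∀ s ∈ K, ∀ x ∈ closedBall xs R,
      frobeniusNormSq (fderiv ℝ (v s) x) ≤ M := by
    have hc : ContinuousOn (fun z : ℝ × (EuclideanSpace ℝ (Fin 3)) => frobeniusNormSq (fderiv ℝ (v z.1) z.2))
        (K ×ˢ closedBall xs R) :=
      (continuous_frobeniusNormSq_clm.comp_continuousOn hD.continuousOn).mono
        (prod_mono Subset.rfl (subset_univ _))
    obtain ⟨M, hM⟩ := (hK.prod (isCompact_closedBall xs R)).exists_bound_of_continuousOn hc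
    refine ⟨max M 0, le_max_right _ _, fun s hs x hx => ?_⟩
    have h := hM (s, x) ⟨hs, hx⟩
    rw [Real.norm_eq_abs, abs_of_nonneg (frobeniusNormSq_nonneg _)] at h
    exact h.trans (le_max_left _ _)
  refine hardyEnergyBound_ledger_continuousOn_integral
    (w := (closedBall xs R).indicator fun x => M * ‖x - x₀‖⁻¹) (fun s hs => ?_) (fun s hs => ?_) ?_ ?_
  · have h1 : Continuous fun x => frobeniusNormSq (fderiv ℝ (v s) x) :=
      continuous_frobeniusNormSq_clm.comp
        ((hv.contDiff_slice (hKS hs)).continuous_fderiv (by simp))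
    exact ((((hardyEnergyBound_ledger_cutoff_continuous xs hR).mul h1).measurable).div
      ((continuous_id.sub continuous_const).norm).measurable).aestronglyMeasurable
  · refine Eventually.of_forall fun x => ?_
    by_cases hx : x ∈ closedBall xs R
    · rw [indicator_of_mem hx, Real.norm_eq_abs, abs_div, abs_mul, abs_of_nonneg (norm_nonneg _),
        abs_of_nonneg (frobeniusNormSq_nonneg _), div_eq_mul_inv]
      refine mul_le_mul ?_ le_rfl (inv_nonneg.2 (norm_nonneg _)) hM0
      calc |φ x| * frobeniusNormSq (fderiv ℝ (v s) x) ≤ 1 * M :=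
            mul_le_mul (hardyEnergyBound_ledger_cutoff_abs_le_one xs hR x) (hM s hs x hx)
              (frobeniusNormSq_nonneg _) zero_le_one
        _ = M := one_mul M
    · rw [indicator_of_notMem hx]
      have h0 : φ x = 0 := by
        by_contra h
        exact hx (ball_subset_closedBall (hardyEnergyBound_ledger_mem_ball_of_cutoff_ne_zero xs hR h))
      rw [h0, zero_mul, zero_div, norm_zero]
  · exact IntegrableOn.integrable_indicator
      ((hardyEnergyBound_ledger_integrableOn_inv_closedBall x₀ xs R).const_mul M) measurableSet_closedBall
  · refine Eventually.of_forall fun x => ?_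
    exact (continuousOn_const.mul (continuous_frobeniusNormSq_clm.comp_continuousOn
      (hardyEnergyBound_ledger_continuousOn_timeLine hD x))).div_const _

/-! ### The right side of the identity `s ↦ ∫ (A + B_p − C_p)(s)` -/

include hx₀ hL₁0 hL₂0 hL₁ hL₂ hK hKS hv hp in
/-- **The right side of the localised identity is continuous in time** on `K`. -/
theorem hardyEnergyBound_ledger_continuousOn_rhs (ν : ℝ) :
    ContinuousOn (fun s => ∫ x,
      (hardyEnergyBound_ledgerA ν (hardyEnergyBound_ledger_cutoff xs hR) (v s) x₀ x +
        hardyEnergyBound_ledgerB (hardyEnergyBound_ledger_cutoff xs hR) (v s) (p s) x₀ x -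
        hardyEnergyBound_ledgerC (hardyEnergyBound_ledger_cutoff xs hR) (v s) (p s) x₀ x)) K := by
  set φ := hardyEnergyBound_ledger_cutoff xs hR with hφ
  have hvK : IsSmoothSpaceTimeOn K v := hv.mono hKS
  have hpK : IsSmoothSpaceTimeOn K p := hp.mono hKS
  obtain ⟨Mv, hMv0, hMv⟩ := hardyEnergyBound_ledger_exists_bound hK hvK xs R
  obtain ⟨Mp, hMp0, hMp⟩ := hardyEnergyBound_ledger_exists_bound hK hpK xs R
  set a : ℝ := |ν| * (L₂ * (4 / R) + 2 * L₁ * (16 / R ^ 2)) with ha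
  set K₁ : ℝ := a * Mv ^ 2 + 4 * L₁ / R * ((Mv ^ 2 + 2 * Mp) * Mv) with hK₁
  set K₂ : ℝ := 2 * ((Mv ^ 2 / 2 + Mp) * Mv) with hK₂
  refine hardyEnergyBound_ledger_continuousOn_integral
    (w := (closedBall xs R).indicator fun x => K₁ + K₂ * (‖x - x₀‖ ^ 2)⁻¹)
    (fun s hs => ?_) (fun s hs => ?_) ?_ ?_
  · have hvc : Continuous (v s) := (hv.contDiff_slice (hKS hs)).continuous
    have hpc : Continuous (p s) := (hp.contDiff_slice (hKS hs)).continuous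
    exact ((hardyEnergyBound_ledger_measurable_ledgerA hR ν hvc).aestronglyMeasurable.add
      (hardyEnergyBound_ledger_aestronglyMeasurable_ledgerB hR hvc hpc.aestronglyMeasurable)).sub
      (hardyEnergyBound_ledger_aestronglyMeasurable_ledgerC hR hvc hpc.aestronglyMeasurable)
  · refine Eventually.of_forall fun x => ?_
    by_cases hx : x ∈ closedBall xs R
    · rw [indicator_of_mem hx, Real.norm_eq_abs]
      have hvx := hMv s hs x hx
      have hpx : |p s x| ≤ Mp := by rw [← Real.norm_eq_abs]; exact hMp s hs x hx
      have h1 := hardyEnergyBound_ledger_abs_ledgerA_le hR hx₀ hL₁0 hL₂0 hL₁ hL₂ ν (v s) x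
      have h2 := hardyEnergyBound_ledger_abs_ledgerB_le hR hx₀ hL₁0 hL₁ (v s) (p s) x
      have h3 := hardyEnergyBound_ledger_abs_ledgerC_le (xs := xs) (x₀ := x₀) hR (v s) (p s) x
      have hr0 : 0 ≤ (‖x - x₀‖ ^ 2)⁻¹ := by positivity
      have ha0 : 0 ≤ a := by positivity
      have hb1 : ‖v s x‖ ^ 2 ≤ Mv ^ 2 := pow_le_pow_left₀ (norm_nonneg _) hvx 2
      have hb2 : (‖v s x‖ ^ 2 + 2 * |p s x|) * ‖v s x‖ ≤ (Mv ^ 2 + 2 * Mp) * Mv :=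
        mul_le_mul (by linarith) hvx (norm_nonneg _) (by positivity)
      have hb3 : (‖v s x‖ ^ 2 / 2 + |p s x|) * ‖v s x‖ ≤ (Mv ^ 2 / 2 + Mp) * Mv :=
        mul_le_mul (by linarith) hvx (norm_nonneg _) (by positivity)
      calc |hardyEnergyBound_ledgerA ν φ (v s) x₀ x + hardyEnergyBound_ledgerB φ (v s) (p s) x₀ x -
            hardyEnergyBound_ledgerC φ (v s) (p s) x₀ x|
          ≤ |hardyEnergyBound_ledgerA ν φ (v s) x₀ x| + |hardyEnergyBound_ledgerB φ (v s) (p s) x₀ x| +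
            |hardyEnergyBound_ledgerC φ (v s) (p s) x₀ x| :=
            (abs_sub _ _).trans (add_le_add (abs_add_le _ _) le_rfl)
        _ ≤ a * ‖v s x‖ ^ 2 + 4 * L₁ / R * ((‖v s x‖ ^ 2 + 2 * |p s x|) * ‖v s x‖) +
            2 * ((‖v s x‖ ^ 2 / 2 + |p s x|) * ‖v s x‖ * (‖x - x₀‖ ^ 2)⁻¹) :=
            add_le_add (add_le_add h1 h2) h3
        _ ≤ a * Mv ^ 2 + 4 * L₁ / R * ((Mv ^ 2 + 2 * Mp) * Mv) +
            2 * ((Mv ^ 2 / 2 + Mp) * Mv * (‖x - x₀‖ ^ 2)⁻¹) := by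
            refine add_le_add (add_le_add (mul_le_mul_of_nonneg_left hb1 ha0)
              (mul_le_mul_of_nonneg_left hb2 (by positivity))) ?_
            exact mul_le_mul_of_nonneg_left (mul_le_mul_of_nonneg_right hb3 hr0) zero_le_two
        _ = K₁ + K₂ * (‖x - x₀‖ ^ 2)⁻¹ := by rw [hK₁, hK₂]; ring
    · rw [indicator_of_notMem hx, hardyEnergyBound_ledgerA_eq_zero hR ν (v s) hx,
        hardyEnergyBound_ledgerB_eq_zero hR (v s) (p s) hx,
        hardyEnergyBound_ledgerC_eq_zero hR (v s) (p s) fun h => hx (ball_subset_closedBall h)]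
      simp
  · exact IntegrableOn.integrable_indicator ((integrableOn_const measure_closedBall_lt_top.ne).add
      ((hardyEnergyBound_ledger_integrableOn_inv_sq_closedBall x₀ xs R).const_mul K₂))
      measurableSet_closedBall
  · refine Eventually.of_forall fun x => ?_
    have hvl := hardyEnergyBound_ledger_continuousOn_timeLine hvK x
    have hpl := hardyEnergyBound_ledger_continuousOn_timeLine hpK x
    have hA : ContinuousOn (fun s => hardyEnergyBound_ledgerA ν φ (v s) x₀ x) K := by
      unfold hardyEnergyBound_ledgerA
      exact (continuousOn_const.mul (hvl.norm.pow 2)).mul continuousOn_const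
    have hB : ContinuousOn (fun s => hardyEnergyBound_ledgerB φ (v s) (p s) x₀ x) K := by
      unfold hardyEnergyBound_ledgerB
      exact (((hvl.norm.pow 2).add (continuousOn_const.mul hpl)).mul
        ((fderiv ℝ φ x).continuous.comp_continuousOn hvl)).div_const _
    have hC : ContinuousOn (fun s => hardyEnergyBound_ledgerC φ (v s) (p s) x₀ x) K := by
      unfold hardyEnergyBound_ledgerC
      exact (((continuousOn_const).mul (((hvl.norm.pow 2).div_const 2).add hpl)).mul
        (hvl.inner continuousOn_const)).div_const _
    exact (hA.add hB).sub hC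

/-! ### The sharp influx, the moment and the pressure mean -/

include hK hKS hv hp in
/-- **The sharp head influx with the classical pressure is continuous in time** on `K`. -/
theorem hardyEnergyBound_ledger_continuousOn_influx :
    ContinuousOn (fun s => ∫ x in ball xs R, hardyEnergyBound_ledgerFlux (v s) (p s) x₀ x) K := by
  have hvK : IsSmoothSpaceTimeOn K v := hv.mono hKS
  have hpK : IsSmoothSpaceTimeOn K p := hp.mono hKS
  obtain ⟨Mv, hMv0, hMv⟩ := hardyEnergyBound_ledger_exists_bound hK hvK xs R
  obtain ⟨Mp, hMp0, hMp⟩ := hardyEnergyBound_ledger_exists_bound hK hpK xs R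
  set K₂ : ℝ := (Mv ^ 2 / 2 + Mp) * Mv with hK₂
  refine hardyEnergyBound_ledger_continuousOn_integral (μ := volume.restrict (ball xs R))
    (w := fun x => K₂ * (‖x - x₀‖ ^ 2)⁻¹) (fun s hs => ?_) (fun s hs => ?_) ?_ ?_
  · exact (hardyEnergyBound_ledger_aestronglyMeasurable_ledgerFlux (hv.contDiff_slice (hKS hs)).continuous
      (hp.contDiff_slice (hKS hs)).continuous.aestronglyMeasurable).restrict
  · refine (ae_restrict_iff' measurableSet_ball).2 (Eventually.of_forall fun x hx => ?_)
    have hx' : x ∈ closedBall xs R := ball_subset_closedBall hx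
    have hvx := hMv s hs x hx'
    have hpx : |p s x| ≤ Mp := by rw [← Real.norm_eq_abs]; exact hMp s hs x hx'
    have hb3 : (‖v s x‖ ^ 2 / 2 + |p s x|) * ‖v s x‖ ≤ (Mv ^ 2 / 2 + Mp) * Mv :=
      mul_le_mul (by nlinarith [pow_le_pow_left₀ (norm_nonneg _) hvx 2]) hvx (norm_nonneg _)
        (by positivity)
    rw [Real.norm_eq_abs]
    exact (hardyEnergyBound_ledger_abs_ledgerFlux_le (v s) (p s) x).trans
      (mul_le_mul_of_nonneg_right hb3 (by positivity))
  · exact (hardyEnergyBound_ledger_integrableOn_inv_sq x₀ xs R).const_mul K₂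
  · refine Eventually.of_forall fun x => ?_
    have hvl := hardyEnergyBound_ledger_continuousOn_timeLine hvK x
    have hpl := hardyEnergyBound_ledger_continuousOn_timeLine hpK x
    unfold hardyEnergyBound_ledgerFlux
    exact ((((hvl.norm.pow 2).div_const 2).add hpl).mul (hvl.inner continuousOn_const)).div_const _

include hK hKS hv in
/-- **The moment `s ↦ ∫_{B_R} ⟨v(s), x − x₀⟩/r³` is continuous in time** on `K`. -/
theorem hardyEnergyBound_ledger_continuousOn_moment :
    ContinuousOn (fun s => ∫ x in ball xs R, inner ℝ (v s x) (x - x₀) / ‖x - x₀‖ ^ 3) K := by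
  have hvK : IsSmoothSpaceTimeOn K v := hv.mono hKS
  obtain ⟨Mv, hMv0, hMv⟩ := hardyEnergyBound_ledger_exists_bound hK hvK xs R
  refine hardyEnergyBound_ledger_continuousOn_integral (μ := volume.restrict (ball xs R))
    (w := fun x => Mv * (‖x - x₀‖ ^ 2)⁻¹) (fun s hs => ?_) (fun s hs => ?_) ?_ ?_
  · have hvc : Continuous (v s) := (hv.contDiff_slice (hKS hs)).continuous
    exact (((hvc.inner (continuous_id.sub continuous_const)).measurable.div
      (((continuous_id.sub continuous_const).norm).pow 3).measurable).aestronglyMeasurable).restrict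
  · refine (ae_restrict_iff' measurableSet_ball).2 (Eventually.of_forall fun x hx => ?_)
    rw [Real.norm_eq_abs]
    exact (hardyEnergyBound_ledger_abs_inner_div_cube_le (v s x) x x₀).trans
      (mul_le_mul_of_nonneg_right (hMv s hs x (ball_subset_closedBall hx)) (by positivity))
  · exact (hardyEnergyBound_ledger_integrableOn_inv_sq x₀ xs R).const_mul Mv
  · refine Eventually.of_forall fun x => ?_
    exact ((hardyEnergyBound_ledger_continuousOn_timeLine hvK x).inner continuousOn_const).div_const _

include hK hKS hp in
/-- **The pressure mean `s ↦ ∫_{B̄_R} p(s)` is continuous in time** on `K`. -/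
theorem hardyEnergyBound_ledger_continuousOn_pressureMean :
    ContinuousOn (fun s => ∫ x in closedBall xs R, p s x) K := by
  have hpK : IsSmoothSpaceTimeOn K p := hp.mono hKS
  obtain ⟨Mp, hMp0, hMp⟩ := hardyEnergyBound_ledger_exists_bound hK hpK xs R
  refine hardyEnergyBound_ledger_continuousOn_integral (μ := volume.restrict (closedBall xs R))
    (w := fun _ => Mp) (fun s hs => ?_) (fun s hs => ?_) ?_ ?_
  · exact ((hp.contDiff_slice (hKS hs)).continuous.aestronglyMeasurable).restrict
  · exact (ae_restrict_iff' measurableSet_closedBall).2 (Eventually.of_forall fun x hx => hMp s hs x hx)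
  · exact integrableOn_const measure_closedBall_lt_top.ne
  · exact Eventually.of_forall fun x => hardyEnergyBound_ledger_continuousOn_timeLine hpK x

end Time

/-- **Anchor of this helper file** (registered sub-goal of `stub_hardyLedger_of`): time lines of a
jointly smooth field are continuous on the time set. -/
theorem hardyEnergyBound_ledger_timeLine :
    ∀ (K : Set ℝ) (w : ℝ → EuclideanSpace ℝ (Fin 3) → EuclideanSpace ℝ (Fin 3)),
      Literature.Analysis.FluidPDE.IsSmoothSpaceTimeOn K w →
      ∀ (x : EuclideanSpace ℝ (Fin 3)), ContinuousOn (fun s => w s x) K :=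
  fun _ _ hw x => hardyEnergyBound_ledger_continuousOn_timeLine hw x

end Summit.NavierStokesRegularity.NavierStokesRegularity.Theorems

end
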